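import Summits.HubbardSuperconductivity.HubbardSuperconductivity.Theorems.KLProgrammeKLRegimeScaleZeroCovarianceOffSiteProfileBridge
import Summits.HubbardSuperconductivity.HubbardSuperconductivity.Theorems.KLProgrammeKLRegimeScaleZeroBetaWindowGridSum

/-!
# Route `KLProgramme`, crux K3 — engine-flow child (stmt-HubbardSuperconductivity-20437 `KLRegimeEngineV17F2`), stub (C) at `n = 0`,
# located item #22a «(C)-SCALE0-PT2»: THE RECORD FORMAT — `SunsetCellRecord` and the certificate predicate `ScaleZeroSunsetCert`

Seat hubbard-kl-k3c5-p1 (g14; owner of #22a).  What ONE run of KIT JOB A (SCALE0-PT2-CERT-SPEC v2.1 Δ6; two interval-arithmetic implementations) delivers for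
ONE μ-cell, in the pattern of `…CountertermJacksonRemainderCertFrameDefs.CutoffDefectCertFrame`: a small RECORD of rationals that a Lean file can hold (the μ-cell, the
certified disk radius, the `3 × K × N` octave tables and their row totals) and a PROP stating what the kit certified about it — the (huge) profile tables themselves stay in
the kit artifact and enter the Prop EXISTENTIALLY:

`ScaleZeroSunsetCert c` :⟺ `0 < K`, `0 < N`, and there are measurable profiles `P z : ℝ → ℝ≥0∞` (`z ∈ ℤ²`, `0 < ‖z‖∞ ≤ Rc`) such that
* (i) FATTENED PROFILE DOMINATION of the β = ∞ off-site kernel, uniformly on the cell: for `μ ∈ [μlo, μhi]`, `z` in the punctured disk and `|u − t| ≤ 2⁻¹⁰`,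
  `‖(1/2π)·𝓕(G_{μ,z})(u/2π)‖₊ ≤ P z t`, where `G_{μ,z}(ω) = mFourierCoeff (descend (y ↦ Ψ(1, Λ₀; e₀(2πy), ω))) (−z)` is EXACTLY the kernel of p1 g20's door
  `enorm_gridCov_offSite_le_tsum_profile` (hypothesis `hp`), and the fattening radius `2⁻¹⁰` exceeds every grid step `β/4M ≤ 2⁻¹²/β` at `M ≥ klEngM₃`
  (`…ScaleZeroBetaWindowGridSum.tsum_profile_le_of_fattened`);
* (ii) OCTAVE-TABLE DOMINATION: on (β-cell `i` of `[β₀, 2β₀]`, `β₀ = klBetaMin`) × (s-cell `j`), the SITE-SUMMED, WEIGHTED sunset shape of the profiles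
  `Σ_{z} w_k(z)·(Σ_m P z (β(s+m)))²·(Σ_m P (−z) (β(1−s+m)))` is `≤ tab k i j` (weights `w₀ = 1`, `w₁ = ‖z‖₂`, `w₂ = ‖z‖₂²` — the assembly's `hS0`/`hS1`/`hS2`) — the hypothesis
  `hM` of `sunsetShape_le_of_octaveTable` (D6) / `sunsetShape_gridSum_le_of_octaveTable` (β1);
* (iii) ROW TOTALS: `β₀(1+(i+1)/K)·Σ_j tab k i j/N ≤ row k` (the `hS` of D6).
The READER (`…SunsetCertReader`, next) proves `ScaleZeroSunsetCert c →` the rows `hS0/hS1/hS2` of `twoLegRead_frameZero_of_sunsetData` with `bS_k := 2·row k + (tails)` for every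
`μ ∈ cell`, `β ≥ klBetaMin`, `L ≥ klEngL₃`, `M ≥ klEngM₃`; the five fits then read `row k` against the targets 0.04 / 0.16 / 1.0 by `norm_num`.

Definitions only (+ two unfolding lemmas); nothing here asserts (C), any stub of 20437, K3 or superconductivity; no certificate is claimed.
References: BGM 2006 §2.3–§2.4 [cite: BenfattoGiulianiMastropietro2006].
-/

noncomputable section

namespace Summit.HubbardSuperconductivity.HubbardSuperconductivity.Theorems.KLRegimeSplit

set_option linter.dupNamespace false -- summit = problem name (single-conjunct summit), D-0017

open Literature.MathematicalPhysics.QuantumLattice Literature.Probability.LatticeModels Literature.Analysis.FunctionSpaces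
open Summit.HubbardSuperconductivity.HubbardSuperconductivity.Theorems.DispersionFlow
open MeasureTheory Set Finset Complex UnitAddTorus Real
open scoped FourierTransform Nat ENNReal NNReal

/-- **The record of one μ-cell certificate** (all numbers rational; written by `gen_record.py`; the profile tables are NOT in the record). -/
structure SunsetCellRecord where
  /-- the μ-cell `[μlo, μhi]` -/
  μlo : ℚ
  /-- the μ-cell `[μlo, μhi]` -/
  μhi : ℚ
  /-- certified punctured disk: sites `z ∈ ℤ²` with `0 < ‖z‖∞ ≤ Rc` -/
  Rc : ℕ
  /-- number of β-cells of the octave `[klBetaMin, 2·klBetaMin]` -/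
  K : ℕ
  /-- number of s-cells of `(0, 1]` -/
  N : ℕ
  /-- the three site-summed weighted octave tables `tab k i j` (`k = 0, 1, 2`; `i < K`; `j < N`) -/
  tab : Fin 3 → ℕ → ℕ → ℚ
  /-- certified row totals `row k ≥ max_i klBetaMin(1+(i+1)/K)·Σ_j tab k i j / N` -/
  row : Fin 3 → ℚ

namespace SunsetCellRecord

/-- The certified punctured disk `{z : 0 < ‖z‖∞ ≤ Rc}` as a finset of `ℤ²`. -/
def disk (c : SunsetCellRecord) : Finset (Fin 2 → ℤ) :=
  (Fintype.piFinset fun _ : Fin 2 => Finset.Icc (-(c.Rc : ℤ)) c.Rc).filter (· ≠ 0)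

/-- The site weights of the three certified rows: `1`, `‖z‖₂`, `‖z‖₂²` (as `ℝ≥0∞`). -/
def siteWeight (k : Fin 3) (z : Fin 2 → ℤ) : ℝ≥0∞ :=
  ENNReal.ofReal (Real.sqrt (((z 0 : ℝ)) ^ 2 + ((z 1 : ℝ)) ^ 2) ^ (k : ℕ))

/-- Membership in the disk, unfolded. -/
theorem mem_disk (c : SunsetCellRecord) (z : Fin 2 → ℤ) :
    z ∈ c.disk ↔ (∀ j, -(c.Rc : ℤ) ≤ z j ∧ z j ≤ c.Rc) ∧ z ≠ 0 := by
  simp [disk, Fintype.mem_piFinset]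

/-- The weight of row `0` is `1`. -/
theorem siteWeight_zero (z : Fin 2 → ℤ) : siteWeight 0 z = 1 := by
  simp [siteWeight]

end SunsetCellRecord

/-- **`ScaleZeroSunsetCert c`** — what KIT JOB A certifies for the μ-cell record `c` (module docstring (i)–(iii)); a named hypothesis of the reader, discharged by the
compute certificate (job manifest + two implementations), never inside Lean. -/
def ScaleZeroSunsetCert (c : SunsetCellRecord) : Prop :=
  0 < c.K ∧ 0 < c.N ∧
  ∃ P : (Fin 2 → ℤ) → ℝ → ℝ≥0∞, (∀ z, Measurable (P z)) ∧
    -- (i) fattened profile domination of the β = ∞ off-site kernel, uniformly on the μ-cell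
    (∀ μ : ℝ, (c.μlo : ℝ) ≤ μ → μ ≤ c.μhi → ∀ z ∈ c.disk, ∀ t u : ℝ, |u - t| ≤ (2 : ℝ)⁻¹ ^ 10 →
      (‖((1 / (2 * π) : ℝ) : ℂ) * 𝓕 (fun om : ℝ => mFourierCoeff (Torus.descend
          (fun y : Momentum => uvSymbolFn 1 klE0 (frameLevel μ 0 ((2 * π) • y)) om) (uvSpatialSymbol_isLatticePeriodic 1 klE0 μ 0 om))
          (-z)) (u / (2 * π))‖₊ : ℝ≥0∞) ≤ P z t) ∧
    -- (ii) octave-table domination of the site-summed weighted sunset shapes of the profiles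
    (∀ k : Fin 3, ∀ i : ℕ, i < c.K → ∀ j : ℕ, j < c.N → ∀ β : ℝ, klBetaMin * (1 + (i : ℝ) / c.K) ≤ β → β ≤ klBetaMin * (1 + ((i : ℝ) + 1) / c.K) →
      ∀ s : ℝ, (j : ℝ) / c.N < s → s ≤ ((j : ℝ) + 1) / c.N →
        ∑ z ∈ c.disk, SunsetCellRecord.siteWeight k z *
          ((∑' m : ℤ, P z (β * (s + m))) ^ 2 * (∑' m : ℤ, P (-z) (β * (1 - s + m)))) ≤ ENNReal.ofReal (c.tab k i j : ℝ)) ∧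
    -- (iii) row totals
    (∀ k : Fin 3, ∀ i : ℕ, i < c.K →
      ENNReal.ofReal (klBetaMin * (1 + ((i : ℝ) + 1) / c.K)) * ∑ j ∈ Finset.range c.N, ENNReal.ofReal (1 / (c.N : ℝ)) * ENNReal.ofReal (c.tab k i j : ℝ) ≤
        ENNReal.ofReal (c.row k : ℝ))

end Summit.HubbardSuperconductivity.HubbardSuperconductivity.Theorems.KLRegimeSplit

end
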